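import Mathlib
import HarnessLib

/-!
# The JUNK AMPLITUDE from the energy budget: (JB) ⇒ the a-priori bound `A` of the junk race (LADDER §49.4)
  (helper for the λ₀ = 1 layer stmt-NavierStokesRegularity-23908 `MirrorSolitaryWave` and the transfer theorem
  stmt-…-23909 `GradedAdiabaticWake`; route TaoLadderRungTwoFlat; cell harvest/h2-tao-ladder, p1 g21)

The co-moving energy inequality (`…CoMovingEnergyDecay.coMovingEnergyOn_decay_Icc`) needs an a-priori sup bound `A`
on the deviation behind the edge, and the threshold algebra of SPLIT-T48 (`MirrorPulse.junkThreshold`, clause (JB) of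
`CapturedInGauge`) supplies it through the ENERGY BUDGET (theory-1 JUNK-RACE-49 §49.4): total energy is conserved
(`…DatumExistence`) or non-increasing (`…ReachDeflation.ExactEnergyNonincreasingOn`), the captured window retains the
pulse's energy up to the capture error, so every site OUTSIDE the window carries at most the difference. This file is
that bookkeeping for a time-free state `z : Fin 2 → ℤ → ℝ`:

* `sqrt_sum_sq_add_le` — Minkowski on a finset (from Cauchy–Schwarz); `sqrt_sum_sq_ge_sub` — reverse triangle form;
* `sqrt_sum_sq_le_of_abs_le` — a sup bound `δ` on `s` gives `√(Σ_s u²) ≤ δ·√|s|`;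
* `sq_le_energy_outside_window` — **if every partial sum of `Σᵢ zᵢ,ₙ²` is `≤ 2E` and `|z − φ| ≤ δ` on the window `W`,
  then for every shell `n₀ ∉ W`: `z_{i₀,n₀}² ≤ 2E − (max 0 (√(Σ_W Σᵢ φ²) − δ√(2|W|)))²`**;
* `abs_le_of_energy_budget` — the same as `|z_{i₀,n₀}| ≤ √(2E − (…)²)`. With (JB) `E < κ²E_{K₀}(Φ) + β(κ/τ)²` and
  `φ = κΦ(0)` on the window `K₀` this is theory-1's `A ≤ √(2β)·κ/τ + O(√δ)`.

HONEST FRAMING: elementary finite-dimensional inequalities; nothing specific to any lattice is asserted; nothing about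
the Navier–Stokes equations.
-/

noncomputable section

-- the sub-problem namespace repeats the summit name by design (D-0017)
set_option linter.dupNamespace false

namespace Summit.NavierStokesRegularity.NavierStokesRegularity.Theorems

namespace MirrorPulse

variable {α : Type*}

/-- **Minkowski on a finset**: `√(Σ (x+y)²) ≤ √(Σ x²) + √(Σ y²)`. [folklore] -/
theorem sqrt_sum_sq_add_le (s : Finset α) (x y : α → ℝ) :
    Real.sqrt (∑ a ∈ s, (x a + y a) ^ 2) ≤ Real.sqrt (∑ a ∈ s, x a ^ 2) + Real.sqrt (∑ a ∈ s, y a ^ 2) := by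
  set X := Real.sqrt (∑ a ∈ s, x a ^ 2) with hX
  set Y := Real.sqrt (∑ a ∈ s, y a ^ 2) with hY
  have hx0 : 0 ≤ ∑ a ∈ s, x a ^ 2 := Finset.sum_nonneg fun a _ => sq_nonneg _
  have hy0 : 0 ≤ ∑ a ∈ s, y a ^ 2 := Finset.sum_nonneg fun a _ => sq_nonneg _
  have hX0 : 0 ≤ X := Real.sqrt_nonneg _
  have hY0 : 0 ≤ Y := Real.sqrt_nonneg _
  have hXX : X * X = ∑ a ∈ s, x a ^ 2 := Real.mul_self_sqrt hx0
  have hYY : Y * Y = ∑ a ∈ s, y a ^ 2 := Real.mul_self_sqrt hy0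
  -- Cauchy–Schwarz
  have hcs : (∑ a ∈ s, x a * y a) ^ 2 ≤ (∑ a ∈ s, x a ^ 2) * ∑ a ∈ s, y a ^ 2 :=
    Finset.sum_mul_sq_le_sq_mul_sq s x y
  have hxy : ∑ a ∈ s, x a * y a ≤ X * Y := by
    have h1 : (∑ a ∈ s, x a * y a) ^ 2 ≤ (X * Y) ^ 2 := by
      calc (∑ a ∈ s, x a * y a) ^ 2 ≤ (∑ a ∈ s, x a ^ 2) * ∑ a ∈ s, y a ^ 2 := hcs
        _ = (X * Y) ^ 2 := by rw [← hXX, ← hYY]; ring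
    exact (abs_le_of_sq_le_sq' h1 (mul_nonneg hX0 hY0)).2
  have hexp : ∑ a ∈ s, (x a + y a) ^ 2 = (∑ a ∈ s, x a ^ 2) + 2 * (∑ a ∈ s, x a * y a) + ∑ a ∈ s, y a ^ 2 := by
    rw [Finset.mul_sum, ← Finset.sum_add_distrib, ← Finset.sum_add_distrib]
    exact Finset.sum_congr rfl fun a _ => by ring
  have hle : ∑ a ∈ s, (x a + y a) ^ 2 ≤ (X + Y) ^ 2 := by
    rw [hexp]; nlinarith [hxy, hXX, hYY]
  calc Real.sqrt (∑ a ∈ s, (x a + y a) ^ 2) ≤ Real.sqrt ((X + Y) ^ 2) := Real.sqrt_le_sqrt hle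
    _ = X + Y := Real.sqrt_sq (add_nonneg hX0 hY0)

/-- **Reverse triangle form**: `√(Σ x²) ≥ √(Σ y²) − √(Σ (x − y)²)`. [folklore] -/
theorem sqrt_sum_sq_ge_sub (s : Finset α) (x y : α → ℝ) :
    Real.sqrt (∑ a ∈ s, y a ^ 2) - Real.sqrt (∑ a ∈ s, (x a - y a) ^ 2) ≤ Real.sqrt (∑ a ∈ s, x a ^ 2) := by
  have h := sqrt_sum_sq_add_le s x (fun a => y a - x a)
  have e1 : ∑ a ∈ s, (x a + (y a - x a)) ^ 2 = ∑ a ∈ s, y a ^ 2 :=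
    Finset.sum_congr rfl fun a _ => by ring
  have e2 : ∑ a ∈ s, (y a - x a) ^ 2 = ∑ a ∈ s, (x a - y a) ^ 2 :=
    Finset.sum_congr rfl fun a _ => by ring
  rw [e1, e2] at h
  linarith

/-- A sup bound on a finset gives an `ℓ²` bound: `|u| ≤ δ` on `s` ⇒ `√(Σ_s u²) ≤ δ·√|s|`. [folklore] -/
theorem sqrt_sum_sq_le_of_abs_le (s : Finset α) {u : α → ℝ} {δ : ℝ} (hδ : 0 ≤ δ) (hu : ∀ a ∈ s, |u a| ≤ δ) :
    Real.sqrt (∑ a ∈ s, u a ^ 2) ≤ δ * Real.sqrt (s.card : ℝ) := by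
  have hle : ∑ a ∈ s, u a ^ 2 ≤ ∑ a ∈ s, δ ^ 2 :=
    Finset.sum_le_sum fun a ha => by
      rw [← sq_abs]; exact pow_le_pow_left₀ (abs_nonneg _) (hu a ha) 2
  rw [Finset.sum_const, nsmul_eq_mul] at hle
  calc Real.sqrt (∑ a ∈ s, u a ^ 2) ≤ Real.sqrt ((s.card : ℝ) * δ ^ 2) := Real.sqrt_le_sqrt hle
    _ = Real.sqrt (s.card : ℝ) * δ := by
        rw [Real.sqrt_mul (Nat.cast_nonneg _), Real.sqrt_sq hδ]
    _ = δ * Real.sqrt (s.card : ℝ) := mul_comm _ _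

/-- **ENERGY OUTSIDE A CAPTURED WINDOW.** If every partial sum of the site energies of the state `z` is at most `2E`
(`Σ_{n∈S} Σᵢ zᵢ,ₙ² ≤ 2E` for all finite `S` — energy conservation or non-increase, no summability bookkeeping) and `z`
is `δ`-close to a reference `φ` on the finite window `W` (`|zᵢ,ₙ − φᵢ,ₙ| ≤ δ`, `n ∈ W`), then every site outside the
window obeys `z_{i₀,n₀}² ≤ 2E − (max 0 (√(Σ_{n∈W}Σᵢ φᵢ,ₙ²) − δ·√(2|W|)))²`. [cite: Tao2016AveragedNS, §4 (4.3)
(energy identity); route TaoLadderRungTwoFlat, L8b (LADDER §49.4: (JB) ⇒ junk amplitude)] -/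
theorem sq_le_energy_outside_window {z φ : Fin 2 → ℤ → ℝ} {E δ : ℝ} (W : Finset ℤ)
    (hE : ∀ S : Finset ℤ, ∑ n ∈ S, ∑ i : Fin 2, z i n ^ 2 ≤ 2 * E) (hδ : 0 ≤ δ)
    (hdev : ∀ i, ∀ n ∈ W, |z i n - φ i n| ≤ δ) {n₀ : ℤ} (hn₀ : n₀ ∉ W) (i₀ : Fin 2) :
    z i₀ n₀ ^ 2 ≤ 2 * E - (max 0 (Real.sqrt (∑ n ∈ W, ∑ i : Fin 2, φ i n ^ 2)
      - δ * Real.sqrt (2 * (W.card : ℝ)))) ^ 2 := by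
  -- flatten the window to the finset of sites
  set s : Finset (Fin 2 × ℤ) := Finset.univ ×ˢ W with hs
  have hflat : ∀ f : Fin 2 → ℤ → ℝ, ∑ n ∈ W, ∑ i : Fin 2, f i n ^ 2 = ∑ p ∈ s, f p.1 p.2 ^ 2 := fun f => by
    rw [hs, Finset.sum_product, Finset.sum_comm]
  have hcard : (s.card : ℝ) = 2 * (W.card : ℝ) := by
    rw [hs, Finset.card_product, Finset.card_univ, Fintype.card_fin]; push_cast; ring
  -- window energy of z from below: √(Σ_W z²) ≥ √(Σ_W φ²) − δ√(2|W|)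
  have hdev' : ∀ p ∈ s, |(fun p : Fin 2 × ℤ => z p.1 p.2 - φ p.1 p.2) p| ≤ δ := by
    intro p hp
    rw [hs, Finset.mem_product] at hp
    exact hdev p.1 p.2 hp.2
  have h1 := sqrt_sum_sq_ge_sub s (fun p => z p.1 p.2) (fun p => φ p.1 p.2)
  have h2 := sqrt_sum_sq_le_of_abs_le s hδ hdev'
  rw [hcard] at h2
  have hZ : max 0 (Real.sqrt (∑ n ∈ W, ∑ i : Fin 2, φ i n ^ 2) - δ * Real.sqrt (2 * (W.card : ℝ)))
      ≤ Real.sqrt (∑ p ∈ s, z p.1 p.2 ^ 2) := by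
    refine max_le (Real.sqrt_nonneg _) ?_
    rw [hflat φ]
    linarith
  have hZsq : (max 0 (Real.sqrt (∑ n ∈ W, ∑ i : Fin 2, φ i n ^ 2) - δ * Real.sqrt (2 * (W.card : ℝ)))) ^ 2
      ≤ ∑ p ∈ s, z p.1 p.2 ^ 2 := by
    have h0 : 0 ≤ ∑ p ∈ s, z p.1 p.2 ^ 2 := Finset.sum_nonneg fun p _ => sq_nonneg _
    calc _ ≤ (Real.sqrt (∑ p ∈ s, z p.1 p.2 ^ 2)) ^ 2 := pow_le_pow_left₀ (le_max_left _ _) hZ 2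
      _ = ∑ p ∈ s, z p.1 p.2 ^ 2 := Real.sq_sqrt h0
  -- the budget on the window plus the outside shell n₀
  have hbud := hE (insert n₀ W)
  rw [Finset.sum_insert hn₀] at hbud
  have hi₀ : z i₀ n₀ ^ 2 ≤ ∑ i : Fin 2, z i n₀ ^ 2 :=
    Finset.single_le_sum (f := fun i => z i n₀ ^ 2) (fun i _ => sq_nonneg _) (Finset.mem_univ i₀)
  rw [hflat z] at hbud
  linarith

/-- **JUNK AMPLITUDE BOUND**: under the hypotheses of `sq_le_energy_outside_window`, every site outside the window has
`|z_{i₀,n₀}| ≤ √(2E − (max 0 (√(Σ_W Σᵢ φ²) − δ√(2|W|)))²)`. With (JB) `E < κ²E_{K₀}(Φ(0)) + β(κ/τ)²`, `φ = κΦ(0)`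
on `W = [−K₀, K₀]` (so `Σ_W Σᵢ φ² = 2κ²E_{K₀}(Φ(0))`) and capture error `δ`, the right side is
`< √(2β)·κ/τ + O(√δ)` — the `A` of the junk race. [cite: Tao2016AveragedNS, §4 (4.3); route TaoLadderRungTwoFlat, L8b (LADDER §49.4)] -/
theorem abs_le_of_energy_budget {z φ : Fin 2 → ℤ → ℝ} {E δ : ℝ} (W : Finset ℤ)
    (hE : ∀ S : Finset ℤ, ∑ n ∈ S, ∑ i : Fin 2, z i n ^ 2 ≤ 2 * E) (hδ : 0 ≤ δ)
    (hdev : ∀ i, ∀ n ∈ W, |z i n - φ i n| ≤ δ) {n₀ : ℤ} (hn₀ : n₀ ∉ W) (i₀ : Fin 2) :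
    |z i₀ n₀| ≤ Real.sqrt (2 * E - (max 0 (Real.sqrt (∑ n ∈ W, ∑ i : Fin 2, φ i n ^ 2)
      - δ * Real.sqrt (2 * (W.card : ℝ)))) ^ 2) :=
  Real.abs_le_sqrt (sq_le_energy_outside_window W hE hδ hdev hn₀ i₀)

end MirrorPulse

end Summit.NavierStokesRegularity.NavierStokesRegularity.Theorems

end
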